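import Mathlib
import HarnessLib
import Literature.MathematicalPhysics.KineticTheory.HardSphereEuler
import Literature.MathematicalPhysics.KineticTheory.HardSphereEulerProofs
import Literature.Analysis.FluidPDE.HardSphereTrajectoryMeasurable
import Literature.Analysis.FluidPDE.HardSphereDynamicsProofs

/-!
# Pathwise window integrability along the hard-sphere flow

Helper (stub `stub_pathwiseWindow`, line `Sketch`) for the crux `KineticCurrentsWindowLDUniform`
(item stmt-AtomisticToContinuum-14662) of the route `OneFlightGossipEngine`.

The crux integrand is a window average `w⁻¹ ∫₀ʷ F(Φ_r z i) dr` of a continuous one-body observable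
`F : 𝕋³ × ℝ³ → ℝ` along particle `i`'s trajectory under a hard-sphere flow `Φ`. Interval integrals
of non-integrable functions are junk (`0`), so the assembly needs genuine interval integrability on
the good set. This file proves it:

* for `z ∈ Φ.good` the orbit `t ↦ Φ_t z` is a hard-sphere trajectory (`HardSphereFlow.isTrajectory`),
  hence Borel measurable in time (`IsHardSphereTrajectory.measurable_torus`);
* kinetic energy is conserved (`IsHardSphereTrajectory.configEnergy_eq_holds`), so every single
  velocity obeys `‖v_i(t)‖² ≤ 2 E(Φ_t z) = 2 E(z)` uniformly in `t`;
* the one-particle state `(Φ_t z) i` therefore stays in the compact set `𝕋³ × closedBall 0 √(2E(z))`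
  on which the continuous `F` is bounded, and a bounded measurable function is integrable on every
  bounded time interval.

No new definitions; nothing about the window LD estimate itself is here.
-/

noncomputable section

open MeasureTheory Set Filter
open scoped ENNReal Topology

namespace Summit.AtomisticToContinuum.HydrodynamicLimit.Theorems.KineticCurrentsWindowLDUniformSketch

open Literature.Analysis.FluidPDE (HardSphereFlow Config localMaxwellian)
open Literature.MathematicalPhysics.KineticTheory (T3 V3 hsDiameter localGibbsLaw localGibbsMeasure)
open Literature.Analysis.FluidPDE

/-- **Pathwise window integrability.** For a hard-sphere flow `Φ` of `N + 1` spheres of diameter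
`hsDiameter σ N` on the flat torus `𝕋³`, a good initial datum `z ∈ Φ.good`, a continuous one-body
observable `f : 𝕋³ × ℝ³ → ℝ` and a particle index `i`, the function `r ↦ f ((Φ_r z) i)` is interval
integrable on every bounded time interval `[a, b]`: it is measurable (the orbit is a right-continuous
hard-sphere trajectory) and bounded (energy conservation confines `(Φ_r z) i` to the compact set
`𝕋³ × closedBall 0 √(2 E(z))`, on which `f` is bounded). -/
theorem stub_pathwiseWindow :
    ∀ (σ : ℝ) (N : ℕ)
      (Φ : HardSphereFlow (Literature.Analysis.FluidPDE.Torus.geometry (Fin 3)) (hsDiameter σ N) (N + 1)),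
      ∀ z ∈ Φ.good, ∀ (f : T3 × V3 → ℝ), Continuous f → ∀ (i : Fin (N + 1)) (a b : ℝ),
        IntervalIntegrable (fun r => f ((Φ.flow r z) i)) volume a b := by
  intro σ N Φ z hz f hf i a b
  have hγ : IsHardSphereTrajectory (Torus.geometry (Fin 3)) (hsDiameter σ N) (N + 1)
      (fun t => Φ.flow t z) := Φ.isTrajectory z hz
  -- measurability in time of the observable along the orbit
  have hmeas : Measurable fun r => f ((Φ.flow r z) i) :=
    hf.measurable.comp ((measurable_pi_apply i).comp hγ.measurable_torus)
  -- uniform velocity bound from conservation of the kinetic energy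
  have hvel : ∀ r, ‖((Φ.flow r z) i).2‖ ≤ Real.sqrt (2 * configEnergy z) := by
    intro r
    have hE : configEnergy (Φ.flow r z) = configEnergy z := by
      have h := IsHardSphereTrajectory.configEnergy_eq_holds hγ r 0
      simpa [Φ.flow_zero z hz] using h
    have hle : ‖((Φ.flow r z) i).2‖ ^ 2 ≤ 2 * configEnergy (Φ.flow r z) := by
      have hs : ‖((Φ.flow r z) i).2‖ ^ 2 ≤ ∑ j, ‖((Φ.flow r z) j).2‖ ^ 2 :=
        Finset.single_le_sum (f := fun j => ‖((Φ.flow r z) j).2‖ ^ 2)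
          (fun j _ => by positivity) (Finset.mem_univ i)
      simp only [configEnergy]
      linarith
    rw [hE] at hle
    exact (le_abs_self _).trans (Real.abs_le_sqrt hle)
  -- the continuous observable is bounded on the compact set `𝕋³ × closedBall 0 R`
  have hK : IsCompact ((Set.univ : Set T3) ×ˢ Metric.closedBall (0 : V3) (Real.sqrt (2 * configEnergy z))) :=
    isCompact_univ.prod (isCompact_closedBall _ _)
  obtain ⟨M, hM⟩ := hK.exists_bound_of_continuousOn hf.continuousOn
  have hbound : ∀ r, ‖f ((Φ.flow r z) i)‖ ≤ M := by
    intro r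
    refine hM _ ⟨Set.mem_univ _, ?_⟩
    rw [Metric.mem_closedBall, dist_zero_right]
    exact hvel r
  -- a bounded measurable function is integrable on the bounded interval `Ι a b`
  rw [intervalIntegrable_iff]
  refine Measure.integrableOn_of_bounded (M := M) ?_ hmeas.aestronglyMeasurable
    (ae_of_all _ fun r => hbound r)
  rw [uIoc]
  exact measure_Ioc_lt_top.ne

end Summit.AtomisticToContinuum.HydrodynamicLimit.Theorems.KineticCurrentsWindowLDUniformSketch

end
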